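import Summits.CriticalPhenomena.PercolationContinuityZ3.Theorems.Transplant.HalfSlabUniquenessLink
import Summits.CriticalPhenomena.PercolationContinuityZ3.Theorems.Transplant.OrthantUniquenessExterior
import HarnessLib

/-!
# Uniqueness in half-slabs, III: the exterior step graph of a box in a slab domain, the inner boundary, and the design at each face

builds on p205010 (kernel theorem, internal audit signed; external expert review pending) — NOT used in this file.
Lane `prim-bschramm`, seat `prim-bschramm-p2` (gen 22; class C1b, METHOD = input substitution; memo `HOME/bschramm/P2-LATTICES.md` §68);
helper file (`--supports stmt-CriticalPhenomena-4575 --as helper`) of the HALF-SLAB UNIQUENESS programme (`HalfSlabUniquenessArms`, `…Link`).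

THE DESIGN.  `D ⊆ S_k` is a slab domain containing the WORKING REGION `{x ∈ S_k | x₁ ≥ 0, x₂ ≥ z_Ω}` and contained in `{x₁ ≥ 0}`
(`D = ℍ𝕊_k` with `z_Ω = -(3N+6)`; `D = ℚ𝕊_k` with `z_Ω = 0`).  The Aizenman–Chayes–Chayes–Fröhlich–Russo criterion is run on the step graph
`withinGraph ℤ³ D` with the boxes `[-N, N]³`, `N ≥ k + 1`; the EXTERIOR steps are `starGraph (withinGraph ℤ³ D) univ [-N,N]³`.
* §1 `innerBdry_cases`: an inner-boundary vertex `u` lies in `D` on the top face `{x₁ = N}`, the right face `{x₂ = N}`, or the left face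
  `{x₂ = -N}` with `u - e₂ ∈ D` (no face in the thin coordinate since `N > k`, no bottom face since `D ⊆ {x₁ ≥ 0}`); regions of `D` off
  the box are exterior (`withinGraph_le_dext`);
* §2 the STATION `Ω = (0, N+2, z_Ω)`, the top `T = 4N+8`, the right end `Z = 3N+6`; for each face an ESCAPE of `≤ 2` edges to an apex
  `b` (top: `u + e₁ + e₂`, steep arm leaning `+e₂`; right: `u + e₂`, leaning `+e₂`; left: `u - e₂`, leaning `-e₂`) whose truncated steep
  region lies in `D`, off the box, inside the strip `{z_Ω ≤ x₂ ≤ Z}`, while the station's shallow arm sweeps the strip below `{x₁ ≤ T}`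
  — so `HalfSlabUniq.link_move` applies: **`move_apex`** (for an apex near the box, `≤ k` extra open edges of `[-M, M]³`,
  `M = k + 7N + 14`, join it to `Ω` through open exterior steps); the three faces and the packaging are in `HalfSlabUniquenessFaces`.
[cite: AizenmanChayesChayesFrohlichRusso1983, §4 (4.25)–(4.27), Lemma 4.3, Lemma 4.2 (a)] [cite: BarskyGrimmettNewman1991, Comment 6 p. 116, Cor. (iii)] -/

noncomputable section

namespace Summit.CriticalPhenomena.PercolationContinuityZ3.Theorems.Transplant

namespace HalfSlabUniq

open MeasureTheory Literature.Probability.Percolation Literature.Probability.LatticeModels SimpleGraph HSU OrthantUniq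
open scoped Classical

variable {k : ℕ} {D : Set (Site 3)} {N : ℕ}

/-! ## §1 The exterior step graph of the box in a slab domain; the inner boundary -/

/-- **Exterior steps**: a lattice step between sites of `D`, not both in the box, is an exterior step. [folklore] -/
theorem dext_adj_of {x y : Site 3} (hxy : (zdGraph 3).Adj x y) (hx : x ∈ D) (hy : y ∈ D) (hbox : ¬ (x ∈ boxSet 3 N ∧ y ∈ boxSet 3 N)) :
    (starGraph (withinGraph (zdGraph 3) D) Set.univ (boxSet 3 N)).Adj x y :=
  ⟨withinGraph_adj.2 ⟨hxy, hx, hy⟩, Set.mem_univ _, Set.mem_univ _, hbox⟩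

/-- **A region of `D` off the box is exterior.** [folklore] -/
theorem withinGraph_le_dext {S : Set (Site 3)} (hS : ∀ x ∈ S, x ∈ D ∧ x ∉ boxSet 3 N) :
    withinGraph (zdGraph 3) S ≤ starGraph (withinGraph (zdGraph 3) D) Set.univ (boxSet 3 N) := by
  intro x y h
  rw [withinGraph_adj] at h
  exact dext_adj_of h.1 (hS x h.2.1).1 (hS y h.2.2).1 fun hb => (hS x h.2.1).2 hb.1

/-- **Classification of the inner boundary.** Let `D ⊆ S_k ∩ {x₁ ≥ 0}` and `N ≥ k + 1`.  If `u ∈ [-N,N]³` has a `D`-neighbour outside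
the box then `u ∈ D` and `u` lies on the top face `u₁ = N`, on the right face `u₂ = N`, or on the left face `u₂ = -N` with `u - e₂ ∈ D`.
[cite: AizenmanChayesChayesFrohlichRusso1983, §4 (4.26) (∂Λ_{N,M})] -/
theorem innerBdry_cases (hD : D ⊆ slab 3 k) (hD1 : ∀ x ∈ D, 0 ≤ x 1) (hN : k + 1 ≤ N) {u : Site 3} (hu : u ∈ boxSet 3 N)
    (hw : ∃ w, w ∉ boxSet 3 N ∧ (withinGraph (zdGraph 3) D).Adj u w) :
    u ∈ D ∧ (u 1 = N ∨ u 2 = N ∨ (u 2 = -(N : ℤ) ∧ u - Pi.single 2 1 ∈ D)) := by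
  obtain ⟨w, hwbox, hadj⟩ := hw
  rw [withinGraph_adj] at hadj
  obtain ⟨hzd, huD, hwD⟩ := hadj
  refine ⟨huD, ?_⟩
  have hw0 : 0 ≤ w 0 ∧ w 0 ≤ (k : ℤ) := hD hwD
  have hw1 := hD1 w hwD
  rw [mem_boxSet_iff] at hu hwbox
  push Not at hwbox
  obtain ⟨m, hm⟩ := hwbox
  obtain ⟨j, hj | hj⟩ := (zdGraph_adj_iff u w).1 hzd
  · -- `w = u + e_j`
    have hwl : ∀ l, w l = u l + (Pi.single j (1 : ℤ) : Site 3) l := fun l => by rw [hj]; rfl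
    by_cases hmj : m = j
    · subst hmj
      have h1 := hwl m
      rw [Pi.single_eq_same] at h1
      have hum := hu m
      have hm' : (N : ℤ) < w m := hm (by omega)
      have hu0 := hu 0
      have hw0' := hwl 0
      by_cases hm0 : m = 0
      · subst hm0; exfalso; omega
      by_cases hm1 : m = 1
      · subst hm1; left; omega
      have hm2 : m = 2 := by fin_cases m <;> simp_all
      subst hm2; right; left; omega
    · have h1 := hwl m
      rw [Pi.single_eq_of_ne hmj, add_zero] at h1
      have := hu m; omega
  · -- `u = w + e_j`
    have hul : ∀ l, u l = w l + (Pi.single j (1 : ℤ) : Site 3) l := fun l => by rw [hj]; rfl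
    by_cases hmj : m = j
    · subst hmj
      have h1 := hul m
      rw [Pi.single_eq_same] at h1
      have hum := hu m
      have hm' : w m < -(N : ℤ) := by
        by_contra h; push Not at h; have := hm h; omega
      by_cases hm0 : m = 0
      · subst hm0; exfalso; omega
      by_cases hm1 : m = 1
      · subst hm1; exfalso; omega
      have hm2 : m = 2 := by fin_cases m <;> simp_all
      subst hm2
      right; right
      refine ⟨by omega, ?_⟩
      have : u - Pi.single 2 1 = w := by rw [hj]; simp
      rw [this]; exact hwD
    · have h1 := hul m
      rw [Pi.single_eq_of_ne hmj, add_zero] at h1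
      have := hu m; omega

/-! ## §2 The design at a face -/

/-- Coordinates of the station `Ω = (0, N+2, z_Ω)`. [folklore] -/
theorem station_coords (N : ℕ) (zΩ : ℤ) :
    (![0, (N : ℤ) + 2, zΩ] : Site 3) 0 = 0 ∧ (![0, (N : ℤ) + 2, zΩ] : Site 3) 1 = N + 2 ∧ (![0, (N : ℤ) + 2, zΩ] : Site 3) 2 = zΩ :=
  ⟨by simp, by simp, by simp⟩

/-- The station lies in the slab. [folklore] -/
theorem station_mem_slab (N : ℕ) (zΩ : ℤ) : (![0, (N : ℤ) + 2, zΩ] : Site 3) ∈ slab 3 k := by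
  show 0 ≤ (![0, (N : ℤ) + 2, zΩ] : Site 3) 0 ∧ (![0, (N : ℤ) + 2, zΩ] : Site 3) 0 ≤ (k : ℤ)
  simp

/-- One escape step: if `K.Adj x y`, `s(x, y) ∈ F` and `ω ∪ F` joins `y` to `z` through open `K`-steps, then it joins `x` to `z`. [folklore] -/
theorem openConnVia_step {K : SimpleGraph (Site 3)} {ω : BondConfig (Site 3)} {F : Finset (Sym2 (Site 3))} {x y z : Site 3}
    (hK : K.Adj x y) (he : s(x, y) ∈ F) (h : ω ∪ ↑F ∈ openConnVia K y z) : ω ∪ ↑F ∈ openConnVia K x z := by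
  refine mem_openConnVia_iff.2 (Reachable.trans (Adj.reachable ?_) (mem_openConnVia_iff.1 h))
  rw [SimpleGraph.inf_adj, openGraph_adj]
  exact ⟨⟨Or.inr (Finset.mem_coe.2 he), hK.ne⟩, hK⟩

/-- Enlarging the sprinkled set preserves the connection. [folklore] -/
theorem openConnVia_mono_finset {K : SimpleGraph (Site 3)} {ω : BondConfig (Site 3)} {F F' : Finset (Sym2 (Site 3))} {y z : Site 3}
    (hFF' : F ⊆ F') (h : ω ∪ ↑F ∈ openConnVia K y z) : ω ∪ ↑F' ∈ openConnVia K y z :=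
  isUpperSet_openConnVia K y z (Set.union_subset_union_right ω (Finset.coe_subset.2 hFF')) h

/-- A lattice edge with both endpoints in `[-M, M]³` lies in `edgesIn ℤ³ [-M,M]³`. [folklore] -/
theorem mem_edgesIn_of_adj {M : ℕ} {x y : Site 3} (hxy : (zdGraph 3).Adj x y) (hx : ∀ j, |x j| ≤ M) (hy : ∀ j, |y j| ≤ M) :
    s(x, y) ∈ edgesIn (zdGraph 3) (box 3 M) := by
  rw [mem_edgesIn_iff]
  refine ⟨(SimpleGraph.mem_edgeSet _).2 hxy, fun v hv => ?_⟩
  rcases Sym2.mem_iff.1 hv with rfl | rfl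
  · exact Finset.mem_coe.1 (subset_boxSet_of_abs_le (S := {v}) (fun z hz j => by rw [Set.mem_singleton_iff.1 hz]; exact hx j) rfl)
  · exact Finset.mem_coe.1 (subset_boxSet_of_abs_le (S := {v}) (fun z hz j => by rw [Set.mem_singleton_iff.1 hz]; exact hy j) rfl)

/-- Coordinates of a point of `[-N, N]³` are bounded by any `M ≥ N`. [folklore] -/
theorem abs_le_of_mem_boxSet {M : ℕ} {u : Site 3} (hu : u ∈ boxSet 3 N) (hNM : N ≤ M) : ∀ j, |u j| ≤ M := fun j => by
  have := (mem_boxSet_iff.1 hu) j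
  rw [abs_le]; constructor <;> omega

/-- A lattice neighbour `u + e_i` of a point of `[-N, N]³` lies in `[-(N+1), N+1]³`. [folklore] -/
theorem add_single_mem_boxSet {u : Site 3} (hu : u ∈ boxSet 3 N) (i : Fin 3) : u + Pi.single i 1 ∈ boxSet 3 (N + 1) := by
  rw [mem_boxSet_iff] at hu ⊢
  intro j
  have := hu j
  by_cases hji : j = i
  · subst hji; simp only [Pi.add_apply, Pi.single_eq_same]; push_cast; constructor <;> omega
  · simp only [Pi.add_apply, Pi.single_eq_of_ne hji, add_zero]; push_cast; constructor <;> omega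

/-- A lattice neighbour `u - e_i` of a point of `[-N, N]³` lies in `[-(N+1), N+1]³`. [folklore] -/
theorem sub_single_mem_boxSet {u : Site 3} (hu : u ∈ boxSet 3 N) (i : Fin 3) : u - Pi.single i 1 ∈ boxSet 3 (N + 1) := by
  rw [mem_boxSet_iff] at hu ⊢
  intro j
  have := hu j
  by_cases hji : j = i
  · subst hji; simp only [Pi.sub_apply, Pi.single_eq_same]; push_cast; constructor <;> omega
  · simp only [Pi.sub_apply, Pi.single_eq_of_ne hji, sub_zero]; push_cast; constructor <;> omega

section Design

variable {zΩ : ℤ} (hD : D ⊆ slab 3 k) (hD1 : ∀ x ∈ D, 0 ≤ x 1) (hW : ∀ x ∈ slab 3 k, 0 ≤ x 1 → zΩ ≤ x 2 → x ∈ D)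
  (hz0 : zΩ ≤ 0) (hzlo : -(3 * (N : ℤ) + 6) ≤ zΩ)

include hW hzlo in
/-- **The station's shallow region**: inside `D`, off the box, below the top `{x₁ ≤ 4N+8}`. [folklore] -/
theorem shallowReg_station_props {x : Site 3} (hx : x ∈ shallowReg k ![0, (N : ℤ) + 2, zΩ] (3 * (N : ℤ) + 6)) :
    x ∈ D ∧ x ∉ boxSet 3 N ∧ x 1 ≤ 4 * (N : ℤ) + 8 ∧ (N : ℤ) + 2 ≤ x 1 ∧ zΩ ≤ x 2 := by
  obtain ⟨h0, h1, h2, h3, hZ⟩ := shallowReg_props hx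
  obtain ⟨-, e1, e2⟩ := station_coords N zΩ
  rw [e1] at h1 h2; rw [e2] at h2 h3
  refine ⟨hW x h0 (by omega) h3, not_mem_boxSet_of_lt (j := 1) (by rw [abs_of_nonneg (by omega)]; omega), by omega, h1, h3⟩

include hz0 hzlo in
/-- **Window of the station's shallow region**: coordinates bounded by `M = k + 7N + 14`. [folklore] -/
theorem shallowReg_station_window {x : Site 3} (hx : x ∈ shallowReg k ![0, (N : ℤ) + 2, zΩ] (3 * (N : ℤ) + 6)) :
    ∀ j, |x j| ≤ (k + 7 * N + 14 : ℕ) := by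
  intro j
  refine (shallowReg_window hx j).trans ?_
  obtain ⟨-, e1, e2⟩ := station_coords N zΩ
  rw [e1, e2]
  have hle : k + ((N : ℤ) + 2).natAbs + zΩ.natAbs + (3 * (N : ℤ) + 6).natAbs ≤ k + 7 * N + 14 := by omega
  exact_mod_cast hle

/-- **Window of a steep region with apex near the box**: coordinates bounded by `M = k + 7N + 14`. [folklore] -/
theorem steepReg_apex_window {σ : ℤ} (hσ : σ = 1 ∨ σ = -1) {b : Site 3} (hb1 : 0 ≤ b 1) (hb1' : b 1 ≤ (N : ℤ) + 1)
    (hb2 : |b 2| ≤ (N : ℤ) + 1) {x : Site 3} (hx : x ∈ steepReg k σ b (4 * (N : ℤ) + 8)) :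
    ∀ j, |x j| ≤ (k + 7 * N + 14 : ℕ) := by
  intro j
  refine (steepReg_window hσ hx j).trans ?_
  have := abs_le.1 hb2
  have hle : k + (b 1).natAbs + (b 2).natAbs + (4 * (N : ℤ) + 8).natAbs ≤ k + 7 * N + 14 := by omega
  exact_mod_cast hle

include hW hz0 hzlo in
/-- **The generic face move.** For an apex `b ∈ S_k` with `0 ≤ b₁ ≤ N + 1`, `|b₂| ≤ N + 1`, a sign `σ = ±1`, and a truncated steep region
lying off the box inside the strip `{z_Ω ≤ x₂ ≤ 3N+6}` (hence inside `D`): on the link event (steep arm from `b` to `{x₁ = 4N+8}`,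
station arm to `{x₂ = 3N+6}`) at most `k` extra open edges of `[-M, M]³` (`M = k + 7N + 14`) join `b` to the station through open
exterior steps. [cite: AizenmanChayesChayesFrohlichRusso1983, §4 Lemma 4.3, Lemma 4.2 (a)] -/
theorem move_apex {σ : ℤ} (hσ : σ = 1 ∨ σ = -1) {b : Site 3} (hb : b ∈ slab 3 k) (hb1 : 0 ≤ b 1) (hb1' : b 1 ≤ (N : ℤ) + 1)
    (hb2 : |b 2| ≤ (N : ℤ) + 1)
    (hS : ∀ x ∈ steepReg k σ b (4 * (N : ℤ) + 8), x ∉ boxSet 3 N ∧ zΩ ≤ x 2 ∧ x 2 ≤ 3 * (N : ℤ) + 6)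
    {ω : BondConfig (Site 3)} (hω : ω ∈ linkEvent k σ b ![0, (N : ℤ) + 2, zΩ] (4 * (N : ℤ) + 8) (3 * (N : ℤ) + 6)) :
    ∃ F : Finset (Sym2 (Site 3)), F ⊆ edgesIn (zdGraph 3) (box 3 (k + 7 * N + 14)) ∧ F.card ≤ k ∧
      ω ∪ ↑F ∈ openConnVia (starGraph (withinGraph (zdGraph 3) D) Set.univ (boxSet 3 N)) b ![0, (N : ℤ) + 2, zΩ] := by
  obtain ⟨-, e1, e2⟩ := station_coords N zΩ
  have hSD : ∀ x ∈ steepReg k σ b (4 * (N : ℤ) + 8), x ∈ D := fun x hx => by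
    obtain ⟨h0, h1, -, -⟩ := steepReg_props hσ hx
    exact hW x h0 (by omega) (hS x hx).2.1
  refine link_move hσ hb (station_mem_slab N zΩ) (by omega) (by rw [e2]; omega) (by rw [e1]; omega)
    (fun x hx => by rw [e2]; exact (hS x hx).2) (fun x hx => (shallowReg_station_props hW hzlo hx).2.2.1)
    (withinGraph_le_dext fun x hx => ⟨hSD x hx, (hS x hx).1⟩)
    (withinGraph_le_dext fun x hx => ⟨(shallowReg_station_props hW hzlo hx).1, (shallowReg_station_props hW hzlo hx).2.1⟩)
    (fun s hs t ht h1 h2 => withinGraph_le_dext fun z hz => ?_) (fun x hx j => ?_) hω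
  · -- the fibre segment between `s` and `t`: same `(x₁, x₂)`, thin coordinate between `s₀` and `t₀`
    obtain ⟨-, -, -, ht1, ht2⟩ := shallowReg_station_props hW hzlo ht
    have hz1 : z 1 = s 1 := eq_of_mem_bbox hz h1
    have hz2 : z 2 = s 2 := eq_of_mem_bbox hz h2
    have hs0 := (steepReg_props hσ hs).1
    have ht0 := (shallowReg_props ht).1
    have hz0' := hz 0
    have hzslab : z ∈ slab 3 k :=
      ⟨le_trans (le_min hs0.1 ht0.1) hz0'.1, le_trans hz0'.2 (max_le hs0.2 ht0.2)⟩
    refine ⟨hW z hzslab (by rw [hz1, h1]; omega) (by rw [hz2, h2]; exact ht2), not_mem_boxSet_of_lt (j := 1) ?_⟩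
    rw [hz1, h1, abs_of_nonneg (by omega)]; omega
  · -- the window
    rcases hx with hx | hx
    · exact steepReg_apex_window hσ hb1 hb1' hb2 hx j
    · exact shallowReg_station_window hz0 hzlo hx j

end Design

end HalfSlabUniq

end Summit.CriticalPhenomena.PercolationContinuityZ3.Theorems.Transplant

end
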